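import Summits.QuantumFields.BalabanUV.Beta.FP.GradedIteratedDerivOn

/-!
# `BalabanUV.Beta.FP.GradedIteratedDerivN` — road «FP» for binder row D1, leaf H2-P, row H2-P-REG-N (owner ASSIGNMENTS after FINDING F-gan24leaf01-g47-1
# «ORDERS 4∕5»): the graded-derivative toolkit of `FP/GradedIteratedDeriv`∕`…On` RE-TYPED ORDER-PARAMETRIC — every statement for `∀ n ≤ N`, any `N : ℕ`,
# in the LOCAL form (`ContDiffOn ℝ N · U`, `IsOpen U`, `x ∈ U`); the product constant is `2^N·M^{m+m′}·C·C′`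

HONEST DEPENDENCY (page 1, mandatory): continuum YM on T⁴ ⇐ BetaPertH ∧ nine spine estimates (0/9 proved); BetaPertH ⇐ (D1) ∧ (D4) ∧ CAP+tail;
G-an2-4 gates asym, D1 and NE2/3/4.  HONEST FRAMING (cell contract, verbatim): «discharging `BetaPertH` makes Bałaban's UV stability UNCONDITIONAL —
a real constructive-QFT result; it is NOT the continuum limit and NOT the Clay problem.»  THIS MODULE DISCHARGES NOTHING of the wall: [folklore] one-variable
calculus over Mathlib (`norm_iteratedFDerivWithin_mul_le`, `iteratedFDerivWithin_of_isOpen`, `ContDiffOn.contDiffAt`, `iteratedDeriv_add`, `iteratedDeriv_const_mul`,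
`ContDiffOn.differentiableOn_iteratedDerivWithin`, `Nat.sum_range_choose`) and the atoms of `FP/GradedIteratedDeriv` (p234468).  0 def; no `def … : Prop`;
nothing cited; 0 sorry; NOT D1, NOT BetaPertH, NOT continuum, NOT Clay.

ABSOLUTE RULE (cell charter, verbatim): «No internally-minted statement may enter as a cited fact. Every hypothesis is either kernel-proved in this package or a
verbatim quotation of a PUBLISHED theorem with page reference. The manuscript(s) under audit are NOT citable for their own disputed steps — they are the thing
under adjudication; programme-internal (2001/route/tribunal) claims are never citable.»

WHY.  H2-P-KER-ASM's (K2)∕(K3) (`‖Δ_j K_B‖ ≤ C∕‖z‖∞⁴`, `‖Δ_iΔ_j K_B‖ ≤ C∕‖z‖∞⁵`) need slice chains of length 4∕5; the order-3 files stay as landed.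
«Graded `(m, C)` up to order `N` at `x`» = the DISPLAYED hypothesis `∀ n ≤ N, ‖iteratedDeriv n f x‖ ≤ C·ρ^(m − n)` (ℕ-truncated exponent).

WHAT (all with `hU : IsOpen U`, `hx : x ∈ U`; `N : ℕ` arbitrary).
* §1 `norm_iteratedDeriv_mul_le_onN`, **`graded_mul_onN`** (`(m,C)·(m′,C′) ↦ (m + m′, 2^N·M^{m+m′}·C·C′)`), `graded_add_onN`, `graded_const_mul_onN`,
  `graded_sum_onN`, `graded_const_N`, `graded_mono_N`, `graded_of_le_order_N`, **`hasDerivAt_iteratedDeriv_onN`** (`j < N`).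
* §2 atoms to every order: **`graded_expSub_N`**∕**`graded_expNegSub_N`** (`|x| ≤ ρ ⟹ ∀ n ≤ N, ‖(e^{±it} − 1)^{(n)}(x)‖ ≤ 1·ρ^(1−n)` — the moving momentum
  factor's derivatives have norm EXACTLY 1 from order 1 on).
Bridges: at `N = 3` these are the statements of `FP/GradedIteratedDerivOn` with `8` replaced by `2^3` (`example`).
Provenance: binder row G-an2-4 owner lineage gan24-p3, gen 16 (prover-b2b-balaban-gan24-p3-g16-0), 2026-08-20; row H2-P-REG-N (owner b2b-balaban-beta-d1-p3).
-/

noncomputable section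

namespace Summit.QuantumFields.BalabanUV.Beta.FP.GradedIteratedDerivN

open Complex
open scoped BigOperators Topology
open Summit.QuantumFields.BalabanUV.Beta.FP.GradedIteratedDeriv (pow_le_pow_mul_pow iteratedDeriv_sub_const contDiff_cexpI contDiff_cexpNegI
  iteratedDeriv_cexpI iteratedDeriv_cexpNegI norm_expNegSub_le)

/-! ## §1 The local graded algebra to order `N` -/

/-- [folklore] the Leibniz BOUND at a point of an open set from `ContDiffOn ℝ N`, for every `n ≤ N`. -/
theorem norm_iteratedDeriv_mul_le_onN {U : Set ℝ} (hU : IsOpen U) {x : ℝ} (hx : x ∈ U) {N : ℕ} {f g : ℝ → ℂ}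
    (hf : ContDiffOn ℝ N f U) (hg : ContDiffOn ℝ N g U) {n : ℕ} (hn : n ≤ N) :
    ‖iteratedDeriv n (fun y => f y * g y) x‖
      ≤ ∑ i ∈ Finset.range (n + 1), (n.choose i : ℝ) * ‖iteratedDeriv i f x‖ * ‖iteratedDeriv (n - i) g x‖ := by
  have h := norm_iteratedFDerivWithin_mul_le (𝕜 := ℝ) (N := (N : WithTop ℕ∞)) hf hg hU.uniqueDiffOn hx (n := n) (by exact_mod_cast hn)
  rw [iteratedFDerivWithin_of_isOpen n hU hx, norm_iteratedFDeriv_eq_norm_iteratedDeriv] at h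
  refine h.trans (le_of_eq (Finset.sum_congr rfl fun i _ => ?_))
  rw [iteratedFDerivWithin_of_isOpen i hU hx, iteratedFDerivWithin_of_isOpen (n - i) hU hx, norm_iteratedFDeriv_eq_norm_iteratedDeriv,
    norm_iteratedFDeriv_eq_norm_iteratedDeriv]

/-- [folklore] `Σ_{i ≤ n} C(n,i) = 2^n ≤ 2^N` for `n ≤ N`. -/
theorem sum_choose_le_two_pow {n N : ℕ} (hn : n ≤ N) : ∑ i ∈ Finset.range (n + 1), (n.choose i : ℝ) ≤ 2 ^ N := by
  have h : ∑ i ∈ Finset.range (n + 1), (n.choose i : ℝ) = (2 : ℝ) ^ n := by exact_mod_cast Nat.sum_range_choose n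
  rw [h]
  exact pow_le_pow_right₀ (by norm_num) hn

/-- [folklore] **LOCAL PRODUCT RULE TO ORDER `N`**: graded `(m, C)` and `(m′, C′)` up to order `N` at `x ∈ U` (open), both `ContDiffOn ℝ N · U`,
`0 ≤ C, C′`, `0 ≤ ρ ≤ M`, `1 ≤ M` ⟹ the product is graded `(m + m′, 2^N·M^{m+m′}·C·C′)` up to order `N`. -/
theorem graded_mul_onN {U : Set ℝ} (hU : IsOpen U) {x : ℝ} (hx : x ∈ U) {N m m' : ℕ} {C C' ρ M : ℝ} {f g : ℝ → ℂ}
    (hf : ContDiffOn ℝ N f U) (hg : ContDiffOn ℝ N g U) (hC : 0 ≤ C) (hC' : 0 ≤ C')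
    (hF : ∀ n ≤ N, ‖iteratedDeriv n f x‖ ≤ C * ρ ^ (m - n)) (hG : ∀ n ≤ N, ‖iteratedDeriv n g x‖ ≤ C' * ρ ^ (m' - n))
    (hρ : 0 ≤ ρ) (hρM : ρ ≤ M) (hM : 1 ≤ M) :
    ∀ n ≤ N, ‖iteratedDeriv n (fun y => f y * g y) x‖ ≤ 2 ^ N * M ^ (m + m') * C * C' * ρ ^ (m + m' - n) := by
  intro n hn
  have hM0 : 0 ≤ M := zero_le_one.trans hM
  have hterm : ∀ i ∈ Finset.range (n + 1),
      (n.choose i : ℝ) * ‖iteratedDeriv i f x‖ * ‖iteratedDeriv (n - i) g x‖ ≤ (n.choose i : ℝ) * (M ^ (m + m') * C * C' * ρ ^ (m + m' - n)) := by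
    intro i hi
    have hi' : i ≤ n := Nat.lt_succ_iff.mp (Finset.mem_range.mp hi)
    have h1 := hF i (hi'.trans hn)
    have h2 := hG (n - i) ((Nat.sub_le n i).trans hn)
    have hpow : ρ ^ (m - i) * ρ ^ (m' - (n - i)) ≤ M ^ (m + m') * ρ ^ (m + m' - n) := by
      rw [← pow_add]
      exact pow_le_pow_mul_pow hρ hρM hM (by omega) (by omega)
    rw [mul_assoc]
    refine mul_le_mul_of_nonneg_left ?_ (Nat.cast_nonneg _)
    calc ‖iteratedDeriv i f x‖ * ‖iteratedDeriv (n - i) g x‖ ≤ (C * ρ ^ (m - i)) * (C' * ρ ^ (m' - (n - i))) :=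
          mul_le_mul h1 h2 (norm_nonneg _) ((norm_nonneg _).trans h1)
      _ = C * C' * (ρ ^ (m - i) * ρ ^ (m' - (n - i))) := by ring
      _ ≤ C * C' * (M ^ (m + m') * ρ ^ (m + m' - n)) := mul_le_mul_of_nonneg_left hpow (mul_nonneg hC hC')
      _ = M ^ (m + m') * C * C' * ρ ^ (m + m' - n) := by ring
  calc ‖iteratedDeriv n (fun y => f y * g y) x‖
      ≤ ∑ i ∈ Finset.range (n + 1), (n.choose i : ℝ) * ‖iteratedDeriv i f x‖ * ‖iteratedDeriv (n - i) g x‖ :=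
        norm_iteratedDeriv_mul_le_onN hU hx hf hg hn
    _ ≤ ∑ i ∈ Finset.range (n + 1), (n.choose i : ℝ) * (M ^ (m + m') * C * C' * ρ ^ (m + m' - n)) := Finset.sum_le_sum hterm
    _ = (∑ i ∈ Finset.range (n + 1), (n.choose i : ℝ)) * (M ^ (m + m') * C * C' * ρ ^ (m + m' - n)) := by rw [Finset.sum_mul]
    _ ≤ 2 ^ N * (M ^ (m + m') * C * C' * ρ ^ (m + m' - n)) :=
        mul_le_mul_of_nonneg_right (sum_choose_le_two_pow hn) (by positivity)
    _ = 2 ^ N * M ^ (m + m') * C * C' * ρ ^ (m + m' - n) := by ring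

/-- [folklore] `ContDiffOn ℝ N` on an open `U ∋ x` gives `ContDiffAt ℝ n` at `x` for `n ≤ N`. -/
theorem contDiffAt_of_onN {U : Set ℝ} (hU : IsOpen U) {x : ℝ} (hx : x ∈ U) {N : ℕ} {f : ℝ → ℂ} (hf : ContDiffOn ℝ N f U) {n : ℕ} (hn : n ≤ N) :
    ContDiffAt ℝ (n : WithTop ℕ∞) f x :=
  ((hf.of_le (by exact_mod_cast hn)).contDiffAt (hU.mem_nhds hx))

/-- [folklore] **LOCAL SUM RULE TO ORDER `N`**. -/
theorem graded_add_onN {U : Set ℝ} (hU : IsOpen U) {x : ℝ} (hx : x ∈ U) {N m : ℕ} {C C' ρ : ℝ} {f g : ℝ → ℂ}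
    (hf : ContDiffOn ℝ N f U) (hg : ContDiffOn ℝ N g U)
    (hF : ∀ n ≤ N, ‖iteratedDeriv n f x‖ ≤ C * ρ ^ (m - n)) (hG : ∀ n ≤ N, ‖iteratedDeriv n g x‖ ≤ C' * ρ ^ (m - n)) :
    ∀ n ≤ N, ‖iteratedDeriv n (fun y => f y + g y) x‖ ≤ (C + C') * ρ ^ (m - n) := by
  intro n hn
  have e : (fun y => f y + g y) = f + g := rfl
  rw [e, iteratedDeriv_add (contDiffAt_of_onN hU hx hf hn) (contDiffAt_of_onN hU hx hg hn)]
  calc ‖iteratedDeriv n f x + iteratedDeriv n g x‖ ≤ ‖iteratedDeriv n f x‖ + ‖iteratedDeriv n g x‖ := norm_add_le _ _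
    _ ≤ C * ρ ^ (m - n) + C' * ρ ^ (m - n) := add_le_add (hF n hn) (hG n hn)
    _ = (C + C') * ρ ^ (m - n) := by ring

/-- [folklore] **LOCAL SCALAR RULE TO ORDER `N`**. -/
theorem graded_const_mul_onN {U : Set ℝ} (hU : IsOpen U) {x : ℝ} (hx : x ∈ U) {N m : ℕ} {C ρ : ℝ} {f : ℝ → ℂ} (hf : ContDiffOn ℝ N f U)
    (hF : ∀ n ≤ N, ‖iteratedDeriv n f x‖ ≤ C * ρ ^ (m - n)) (c : ℂ) :
    ∀ n ≤ N, ‖iteratedDeriv n (fun y => c * f y) x‖ ≤ ‖c‖ * C * ρ ^ (m - n) := by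
  intro n hn
  rw [iteratedDeriv_const_mul c (contDiffAt_of_onN hU hx hf hn), norm_mul, mul_assoc]
  exact mul_le_mul_of_nonneg_left (hF n hn) (norm_nonneg _)

/-- [folklore] **CONSTANTS TO EVERY ORDER**: if `‖c‖ ≤ C·ρ^m` (`0 ≤ C`, `0 ≤ ρ`) then the constant function is graded of order `m` up to any `N`. -/
theorem graded_const_N (N : ℕ) {m : ℕ} {C ρ : ℝ} (c : ℂ) (hC : 0 ≤ C) (hρ : 0 ≤ ρ) (hc : ‖c‖ ≤ C * ρ ^ m) (x : ℝ) :
    ∀ n ≤ N, ‖iteratedDeriv n (fun _ : ℝ => c) x‖ ≤ C * ρ ^ (m - n) := by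
  intro n _
  rcases Nat.eq_zero_or_pos n with h0 | hpos
  · subst h0; simpa using hc
  · have e : iteratedDeriv n (fun _ : ℝ => c) x = 0 := by rw [iteratedDeriv_const]; simp [hpos.ne']
    rw [e, norm_zero]; positivity

/-- [folklore] **LOCAL FINITE SUMS TO ORDER `N`**. -/
theorem graded_sum_onN {U : Set ℝ} (hU : IsOpen U) {x : ℝ} (hx : x ∈ U) {N : ℕ} {ι : Type*} (s : Finset ι) {m : ℕ} {C : ι → ℝ} {ρ : ℝ}
    {f : ι → ℝ → ℂ} (hf : ∀ i ∈ s, ContDiffOn ℝ N (f i) U) (hF : ∀ i ∈ s, ∀ n ≤ N, ‖iteratedDeriv n (f i) x‖ ≤ C i * ρ ^ (m - n)) :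
    ∀ n ≤ N, ‖iteratedDeriv n (fun y => ∑ i ∈ s, f i y) x‖ ≤ (∑ i ∈ s, C i) * ρ ^ (m - n) := by
  classical
  induction s using Finset.induction_on with
  | empty =>
    intro n hn
    simp only [Finset.sum_empty, zero_mul]
    have e : iteratedDeriv n (fun _ : ℝ => (0 : ℂ)) x = 0 := by
      rw [iteratedDeriv_const]; split_ifs <;> rfl
    rw [e, norm_zero]
  | @insert j s hj ih =>
    have hf' : ∀ i ∈ s, ContDiffOn ℝ N (f i) U := fun i hi => hf i (Finset.mem_insert_of_mem hi)
    have hF' : ∀ i ∈ s, ∀ n ≤ N, ‖iteratedDeriv n (f i) x‖ ≤ C i * ρ ^ (m - n) := fun i hi => hF i (Finset.mem_insert_of_mem hi)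
    have hsum : ContDiffOn ℝ N (fun y => ∑ i ∈ s, f i y) U := ContDiffOn.sum fun i hi => hf' i hi
    have h := graded_add_onN hU hx (hf j (Finset.mem_insert_self j s)) hsum (hF j (Finset.mem_insert_self j s)) (ih hf' hF')
    have e : (fun y => ∑ i ∈ insert j s, f i y) = fun y => f j y + ∑ i ∈ s, f i y := by
      funext y; rw [Finset.sum_insert hj]
    rw [Finset.sum_insert hj, e]
    exact h

/-- [folklore] monotonicity in the constant, to order `N`. -/
theorem graded_mono_N {N m : ℕ} {C C' ρ : ℝ} {f : ℝ → ℂ} {x : ℝ} (hF : ∀ n ≤ N, ‖iteratedDeriv n f x‖ ≤ C * ρ ^ (m - n)) (hC : C ≤ C')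
    (hρ : 0 ≤ ρ) : ∀ n ≤ N, ‖iteratedDeriv n f x‖ ≤ C' * ρ ^ (m - n) :=
  fun n hn => (hF n hn).trans (mul_le_mul_of_nonneg_right hC (pow_nonneg hρ _))

/-- [folklore] LOWERING THE ORDER, to order `N`: graded `(m, C)` ⟹ graded `(m′, M^{m−m′}·C)` for `m′ ≤ m`, `0 ≤ C`, `0 ≤ ρ ≤ M`, `1 ≤ M`. -/
theorem graded_of_le_order_N {N m m' : ℕ} {C ρ M : ℝ} {f : ℝ → ℂ} {x : ℝ} (hF : ∀ n ≤ N, ‖iteratedDeriv n f x‖ ≤ C * ρ ^ (m - n)) (hC : 0 ≤ C)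
    (hm : m' ≤ m) (hρ : 0 ≤ ρ) (hρM : ρ ≤ M) (hM : 1 ≤ M) : ∀ n ≤ N, ‖iteratedDeriv n f x‖ ≤ M ^ (m - m') * C * ρ ^ (m' - n) := by
  intro n hn
  refine (hF n hn).trans ?_
  calc C * ρ ^ (m - n) ≤ C * (M ^ (m - m') * ρ ^ (m' - n)) :=
        mul_le_mul_of_nonneg_left (pow_le_pow_mul_pow hρ hρM hM (by omega) (by omega)) hC
    _ = M ^ (m - m') * C * ρ ^ (m' - n) := by ring

/-- [folklore] a globally `ContDiff ℝ N` function is `ContDiffOn ℝ N` on any set. -/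
theorem contDiffOn_of_contDiffN {N : ℕ} {f : ℝ → ℂ} (hf : ContDiff ℝ N f) (U : Set ℝ) : ContDiffOn ℝ N f U := hf.contDiffOn

/-- [folklore] **THE CHAIN FROM LOCAL REGULARITY, TO ORDER `N`**: `ContDiffOn ℝ N f U` on an open `U`, `t ∈ U`, `j < N` ⟹
`HasDerivAt (iteratedDeriv j f) (iteratedDeriv (j+1) f t) t`. -/
theorem hasDerivAt_iteratedDeriv_onN {U : Set ℝ} (hU : IsOpen U) {N : ℕ} {f : ℝ → ℂ} (hf : ContDiffOn ℝ N f U) {j : ℕ} (hj : j < N) {t : ℝ}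
    (ht : t ∈ U) : HasDerivAt (iteratedDeriv j f) (iteratedDeriv (j + 1) f t) t := by
  have hdiffOn : DifferentiableOn ℝ (iteratedDerivWithin j f U) U :=
    hf.differentiableOn_iteratedDerivWithin (by exact_mod_cast hj) hU.uniqueDiffOn
  have hdiffAt : DifferentiableAt ℝ (iteratedDerivWithin j f U) t := (hdiffOn t ht).differentiableAt (hU.mem_nhds ht)
  have heq : iteratedDerivWithin j f U =ᶠ[𝓝 t] iteratedDeriv j f :=
    Filter.eventuallyEq_of_mem (hU.mem_nhds ht) fun y hy => iteratedDerivWithin_of_isOpen hU hy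
  have h1 : HasDerivAt (iteratedDeriv j f) (deriv (iteratedDerivWithin j f U) t) t :=
    hdiffAt.hasDerivAt.congr_of_eventuallyEq heq.symm
  have hval : deriv (iteratedDerivWithin j f U) t = iteratedDeriv (j + 1) f t := by
    rw [← iteratedDerivWithin_of_isOpen hU ht, iteratedDerivWithin_succ, derivWithin_of_isOpen hU ht]
  rw [hval] at h1
  exact h1

/-! ## §2 The atoms to every order -/

/-- [folklore] **THE MOVING ATOM TO EVERY ORDER**: `|x| ≤ ρ` ⟹ `∀ n ≤ N, ‖(t ↦ e^{it} − 1)^{(n)}(x)‖ ≤ 1·ρ^(1−n)` (norm `≤ |x|` at order 0, EXACTLY `1`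
from order 1 on). -/
theorem graded_expSub_N (N : ℕ) {x ρ : ℝ} (hx : |x| ≤ ρ) :
    ∀ n ≤ N, ‖iteratedDeriv n (fun t : ℝ => cexp ((t : ℂ) * I) - 1) x‖ ≤ 1 * ρ ^ (1 - n) := by
  intro n _
  rcases Nat.eq_zero_or_pos n with h0 | hpos
  · subst h0
    have hc : ‖cexp ((x : ℂ) * I) - 1‖ ≤ |x| := by
      have h := Real.norm_exp_I_mul_ofReal_sub_one_le (x := x)
      rwa [mul_comm, Real.norm_eq_abs] at h
    simpa using hc.trans hx
  · rw [iteratedDeriv_sub_const contDiff_cexpI 1 hpos, iteratedDeriv_cexpI, norm_mul, norm_pow, Complex.norm_I, one_pow, one_mul,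
      Complex.norm_exp_ofReal_mul_I]
    have : 1 - n = 0 := by omega
    simp [this]

/-- [folklore] **THE CONJUGATE MOVING ATOM TO EVERY ORDER**: `|x| ≤ ρ` ⟹ `∀ n ≤ N, ‖(t ↦ e^{−it} − 1)^{(n)}(x)‖ ≤ 1·ρ^(1−n)`. -/
theorem graded_expNegSub_N (N : ℕ) {x ρ : ℝ} (hx : |x| ≤ ρ) :
    ∀ n ≤ N, ‖iteratedDeriv n (fun t : ℝ => cexp (-((t : ℂ) * I)) - 1) x‖ ≤ 1 * ρ ^ (1 - n) := by
  intro n _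
  rcases Nat.eq_zero_or_pos n with h0 | hpos
  · subst h0; simpa using (norm_expNegSub_le x).trans hx
  · rw [iteratedDeriv_sub_const contDiff_cexpNegI 1 hpos, iteratedDeriv_cexpNegI, norm_mul, norm_pow, norm_neg, Complex.norm_I, one_pow,
      one_mul]
    have e : -((x : ℂ) * I) = ((-x : ℝ) : ℂ) * I := by push_cast; ring
    rw [e, Complex.norm_exp_ofReal_mul_I]
    have : 1 - n = 0 := by omega
    simp [this]

/-- [folklore] BRIDGE: at `N = 3` the product rule is `FP/GradedIteratedDerivOn.graded_mul_on` with `8 = 2^3`. -/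
example {U : Set ℝ} (hU : IsOpen U) {x : ℝ} (hx : x ∈ U) {m m' : ℕ} {C C' ρ M : ℝ} {f g : ℝ → ℂ}
    (hf : ContDiffOn ℝ 3 f U) (hg : ContDiffOn ℝ 3 g U) (hC : 0 ≤ C) (hC' : 0 ≤ C')
    (hF : ∀ n ≤ 3, ‖iteratedDeriv n f x‖ ≤ C * ρ ^ (m - n)) (hG : ∀ n ≤ 3, ‖iteratedDeriv n g x‖ ≤ C' * ρ ^ (m' - n))
    (hρ : 0 ≤ ρ) (hρM : ρ ≤ M) (hM : 1 ≤ M) :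
    ∀ n ≤ 3, ‖iteratedDeriv n (fun y => f y * g y) x‖ ≤ 2 ^ 3 * M ^ (m + m') * C * C' * ρ ^ (m + m' - n) :=
  graded_mul_onN (N := 3) hU hx hf hg hC hC' hF hG hρ hρM hM

end Summit.QuantumFields.BalabanUV.Beta.FP.GradedIteratedDerivN

end
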